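/-
Copyright: the b2b-balaban cell (near-miss cell 7), T⁴-continuum fan-out, lineage t4-ne7b-p3 (node U5c LARGE-DEVIATION
member P3).  Released under the licence of the surrounding project.
-/
import Literature.MathematicalPhysics.QuantumFieldTheory.Balaban1983to89.T4StabilitySocket

/-!
# Space-time Peierls ∕ Cramér assembly for NE7b (node U5c, LARGE-DEVIATION member P3): the kernel half of the
# skeleton `t4/skeletons/NE7b-t4-ne7b-p3.md`

Summits-side support leaf of the T⁴-continuum cell (rung (B)+1 on a FINITE torus only; NOT infinite volume, NOT the
mass gap, NOT the Clay statement; NOT a proof of the spine estimate NE7b).  Lineage `t4-ne7b-p3` (generation 1), node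
U5c, BINDER-OWNERS row NE7b co-owner #3 (technique: large-deviation ∕ Cramér–Chernoff estimate on the number of occupied
large-field blocks per scale, the printed `p₀` suppression as rate function).  [folklore] real analysis ∕ finite
combinatorics over ABSTRACT finite families, Mathlib + `T4WeightBudget` + `T4StabilitySocket` only; nothing is quoted
from print and nothing printed is asserted; no `[cite:]` tag.  NE7b is NOT PRINTED and NOT PROVED; this file is the
ASSEMBLY of the route, every leaf of the skeleton entering as a DISPLAYED BINDER.

THE ROUTE (skeleton `HOME/t4/skeletons/NE7b-t4-ne7b-p3.md`, leaves A1–A5).  Space-time cells = (scale `u ≤ K`, block of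
the scale-`u` cover of the unit torus); a term `τ` of a run OCCUPIES a cell when the block lies in the live (pending)
large-field region of `τ`'s history at that scale; a CONTOUR is a connected component of the occupied set.  The bad
class of NE7b (terms carrying a live structure born before the matching scale `j⋆(K)`) is covered by the terms one of
whose contours meets scale `K` and a scale `< j⋆(K)` — a contour of at least `K − j⋆(K) + 2` cells through one of
`≤ Nanc` anchor blocks at the final scale (leaf A2, the Cramér step: at least one occupied cell per scale of age, so the
exponential tilt in the contour volume turns a per-CELL price into a per-SCALE-of-age rate).  Contours of `n` cells
through an anchor number `≤ Δ₁ⁿ` (leaf A1, site animals).  The PINNED-CONTOUR bound (leaf A3, the analytic leaf, in the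
(GD) absolute-majorant currency of RULING R-U5c-GD): the terms having a given contour weigh at most `e^{−s₁ n} · nup`,
`s₁` the per-cell net surplus.  The denominator (leaf A4) is `T4StabilitySocket.LowEnvelope` (from the pinned (B), by
name).  THIS FILE (leaf A5) proves: A1 ∧ A2 ∧ A3 at each `(K, t)` ⇒ `Σ_{Bad} A ≤ Nanc·ϱ^{K−j⋆(K)+1}/(1−ϱ) · nup`,
`ϱ := Δ₁·e^{−s₁} < 1` (§1–§2); + `LowEnvelope` for both runs + `c·K ≤ K − j⋆(K)` ⇒ `T4WeightBudget.RelWeightBound`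
(§3–§4).  The survival condition of the node appears as `ϱ < 1 ⟺ log Δ₁ < s₁` (`rate_lt_one_iff`), i.e. with the
skeleton's readings `s₁ = p̄₀∕(2C₂N′)`, `Δ₁ = e·Δ`: `p₀(g)∕N′ > 2C₂·(1 + log Δ)` — automatic in the printed window.

HONEST DEPENDENCY (cell, verbatim): continuum YM on T⁴ ⇐ BetaPertH ∧ nine spine estimates (0/9 proved); BetaPertH ⇐
(D1) ∧ (D4) ∧ CAP+tail; G-an2-4 gates asym, D1 and NE2/3/4.  This file changes none of it.
-/

open Finset Filter Topology

namespace Summit.QuantumFields.BalabanUV.T4Continuum.SpaceTimePeierls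

open Literature.MathematicalPhysics.QuantumFieldTheory.Balaban1983to89
open T4WeightBudget T4StabilitySocket

noncomputable section

/-! ## §1 The Peierls ∕ Cramér sum at one `(K, t)`: cover + animal count + pinned-contour bound ⇒ numerator bound -/

section OneStep

variable {ι β : Type*} [DecidableEq ι]

/-- **PERSISTENCE FORCES VOLUME** (the deterministic half of the Cramér step, leaf A2): if a finite set of cells
`𝒦` meets every scale of the window `[j, K]` (at least one occupied cell per scale of age), then `K + 1 − j ≤ #𝒦`.
[folklore] -/
theorem card_Icc_le_card_of_meets {γ : Type*} (sc : γ → ℕ) (𝒦 : Finset γ) {j K : ℕ}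
    (hmeet : ∀ u ∈ Icc j K, ∃ c ∈ 𝒦, sc c = u) : K + 1 - j ≤ 𝒦.card := by
  have h : (Icc j K).card ≤ 𝒦.card :=
    card_le_card_of_surjOn sc fun u hu => by
      obtain ⟨c, hc, rfl⟩ := hmeet u hu
      exact ⟨c, hc, rfl⟩
  simpa [Nat.card_Icc] using h

/-- FIBREWISE REGROUPING of a sum by contour size: `Σ_{b ∈ Sh} g (sz b) = Σ_{n ∈ sz(Sh)} #{b ∈ Sh | sz b = n} · g n`.
[folklore] -/
theorem sum_eq_sum_card_fiber_mul (Sh : Finset β) (sz : β → ℕ) (g : ℕ → ℝ) :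
    ∑ b ∈ Sh, g (sz b) = ∑ n ∈ Sh.image sz, ((Sh.filter fun b => sz b = n).card : ℝ) * g n := by
  rw [← sum_fiberwise_of_maps_to' (g := sz) (t := Sh.image sz) (fun b hb => mem_image_of_mem sz hb) g]
  refine sum_congr rfl fun n _ => ?_
  rw [sum_const, nsmul_eq_mul]

/-- **THE PEIERLS ∕ CRAMÉR SUM AT ONE `(K, t)`** (leaf A5, first half).  Data: the run's terms `T` with nonnegative
weights `A` on `T`; a bad class `Bad`; a finite family `Sh` of CONTOUR SHAPES `b` with sizes `sz b`, each pinning a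
class of terms `Pin b ⊆ T`.  Binders: (A2, cover) `Bad ⊆ ⋃_{b ∈ Sh} Pin b` with every shape of size `≥ m`
(`m = K − j⋆(K) + 1` in the application: a contour from scale `K` down to below `j⋆(K)`); (A1, animals) the shapes of
size `n` number `≤ Nanc · Δ₁ⁿ` (anchors at the final scale × connected animals through an anchor); (A3, pinned contour
bound) `Σ_{τ ∈ Pin b} A τ ≤ (e^{−s₁})^{sz b} · nup`.  Conclusion: `Σ_{Bad} A ≤ Nanc · ϱᵐ/(1−ϱ) · nup` with the RATE
`ϱ = Δ₁ · e^{−s₁} < 1` — entropy per cell against net surplus per cell; the exponential tilt in the contour volume is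
the geometric tail. [folklore] -/
theorem sum_bad_le_of_contours (Bad T : Finset ι) (A : ι → ℝ) (Sh : Finset β) (Pin : β → Finset ι) (sz : β → ℕ)
    {Nanc Δ₁ s₁ nup : ℝ} {m : ℕ} (hA : ∀ τ ∈ T, 0 ≤ A τ) (hPin : ∀ b ∈ Sh, Pin b ⊆ T)
    (hcover : Bad ⊆ Sh.biUnion Pin) (hsize : ∀ b ∈ Sh, m ≤ sz b)
    (hcount : ∀ n, ((Sh.filter fun b => sz b = n).card : ℝ) ≤ Nanc * Δ₁ ^ n)
    (hpin : ∀ b ∈ Sh, ∑ τ ∈ Pin b, A τ ≤ Real.exp (-s₁) ^ sz b * nup)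
    (hNanc : 0 ≤ Nanc) (hΔ₁ : 0 ≤ Δ₁) (hnup : 0 ≤ nup) (hϱ : Δ₁ * Real.exp (-s₁) < 1) :
    ∑ τ ∈ Bad, A τ ≤ Nanc * ((Δ₁ * Real.exp (-s₁)) ^ m / (1 - Δ₁ * Real.exp (-s₁))) * nup := by
  set ϱ := Δ₁ * Real.exp (-s₁) with hϱdef
  have hϱ0 : 0 ≤ ϱ := mul_nonneg hΔ₁ (Real.exp_nonneg _)
  -- the union ⋃ Pin b sits inside T
  have hU : Sh.biUnion Pin ⊆ T := biUnion_subset.2 hPin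
  -- nonnegative extension of A off T
  let Ap : ι → ℝ := fun τ => if τ ∈ T then A τ else 0
  have hAp0 : ∀ τ, 0 ≤ Ap τ := fun τ => by
    by_cases h : τ ∈ T
    · simp only [Ap, h, if_true]; exact hA τ h
    · simp only [Ap, h, if_false]; exact le_rfl
  have hApT : ∀ τ ∈ T, Ap τ = A τ := fun τ h => by simp only [Ap, h, if_true]
  calc ∑ τ ∈ Bad, A τ
      ≤ ∑ τ ∈ Sh.biUnion Pin, A τ :=
        sum_le_sum_of_subset_of_nonneg hcover fun τ hτ _ => hA τ (hU hτ)
    _ = ∑ τ ∈ Sh.biUnion Pin, Ap τ := sum_congr rfl fun τ hτ => (hApT τ (hU hτ)).symm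
    _ ≤ ∑ b ∈ Sh, ∑ τ ∈ Pin b, Ap τ := sum_biUnion_le_sum Sh Pin hAp0
    _ = ∑ b ∈ Sh, ∑ τ ∈ Pin b, A τ :=
        sum_congr rfl fun b hb => sum_congr rfl fun τ hτ => hApT τ (hPin b hb hτ)
    _ ≤ ∑ b ∈ Sh, Real.exp (-s₁) ^ sz b * nup := sum_le_sum hpin
    _ = (∑ b ∈ Sh, Real.exp (-s₁) ^ sz b) * nup := by rw [sum_mul]
    _ = (∑ n ∈ Sh.image sz, ((Sh.filter fun b => sz b = n).card : ℝ) * Real.exp (-s₁) ^ n) * nup := by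
        rw [sum_eq_sum_card_fiber_mul Sh sz (fun n => Real.exp (-s₁) ^ n)]
    _ ≤ (∑ n ∈ Sh.image sz, Nanc * ϱ ^ n) * nup := by
        refine mul_le_mul_of_nonneg_right (sum_le_sum fun n _ => ?_) hnup
        calc ((Sh.filter fun b => sz b = n).card : ℝ) * Real.exp (-s₁) ^ n
            ≤ (Nanc * Δ₁ ^ n) * Real.exp (-s₁) ^ n :=
              mul_le_mul_of_nonneg_right (hcount n) (pow_nonneg (Real.exp_nonneg _) n)
          _ = Nanc * ϱ ^ n := by rw [hϱdef, mul_pow]; ring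
    _ = Nanc * (∑ n ∈ Sh.image sz, ϱ ^ n) * nup := by rw [← mul_sum]
    _ ≤ Nanc * (ϱ ^ m / (1 - ϱ)) * nup := by
        refine mul_le_mul_of_nonneg_right (mul_le_mul_of_nonneg_left ?_ hNanc) hnup
        refine sum_pow_le_of_le hϱ0 hϱ fun n hn => ?_
        obtain ⟨b, hb, rfl⟩ := mem_image.1 hn
        exact hsize b hb

/-- THE SURVIVAL CONDITION OF THE ROUTE: the rate `ϱ = Δ₁ · e^{−s₁}` is `< 1` iff the per-cell ENTROPY `log Δ₁` is
beaten by the per-cell NET SURPLUS `s₁` (`Δ₁ > 0`).  With the skeleton's readings `Δ₁ = e·Δ` (site animals in a graph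
of degree `≤ Δ`) and `s₁ = p̄₀ ∕ (2·C₂·N′)` this is the node's «p₀(g)∕N > c·log L·(1+o(1))». [folklore] -/
theorem rate_lt_one_iff {Δ₁ s₁ : ℝ} (hΔ₁ : 0 < Δ₁) : Δ₁ * Real.exp (-s₁) < 1 ↔ Real.log Δ₁ < s₁ := by
  rw [← Real.log_lt_log_iff (mul_pos hΔ₁ (Real.exp_pos _)) one_pos, Real.log_mul hΔ₁.ne' (Real.exp_pos _).ne',
    Real.log_exp, Real.log_one]
  constructor <;> intro h <;> linarith

end OneStep

/-! ## §2 The numerator shape over all `(K, t)` and its instantiation by contour data -/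

section Numerator

variable {ι β : Type*} {l₀ : ℝ} {T : ℕ → Finset ι} {A B : ℕ → ℝ → ι → ℝ}
  {Bad : ℕ → ℝ → Finset ι} {nup mup nlow mlow : ℕ → ℝ → ℝ} {M : ℕ → ℝ} {C : ℝ} {K₀ : ℕ}

/-- NAMED SHAPE `ContourBound l₀ T A Bad nup M K₀` (ONE run; the NUMERATOR half of the (GD) currency in CLASS form):
from `K₀` on and for `|t| ≤ l₀`, the bad class consists of terms and weighs at most `M K · nup K t`.  (§1 produces it
with `M K = Nanc·ϱ^{K−j⋆(K)+1}/(1−ϱ)`; a hypothesis shape, nothing asserted.) [folklore] -/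
structure ContourBound (l₀ : ℝ) (T : ℕ → Finset ι) (A : ℕ → ℝ → ι → ℝ) (Bad : ℕ → ℝ → Finset ι)
    (nup : ℕ → ℝ → ℝ) (M : ℕ → ℝ) (K₀ : ℕ) : Prop where
  /-- the bad class consists of terms -/
  bad_subset : ∀ K t, |t| ≤ l₀ → K₀ ≤ K → Bad K t ⊆ T K
  /-- the numerator bound: bad mass ≤ budget × upper normalisation -/
  num : ∀ K t, |t| ≤ l₀ → K₀ ≤ K → ∑ τ ∈ Bad K t, A K t τ ≤ M K * nup K t

/-- `ContourBound` restricts to any later threshold. [folklore] -/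
theorem ContourBound.of_le (h : ContourBound l₀ T A Bad nup M K₀) {K₁ : ℕ} (h01 : K₀ ≤ K₁) :
    ContourBound l₀ T A Bad nup M K₁ :=
  ⟨fun K t ht hK => h.bad_subset K t ht (h01.trans hK), fun K t ht hK => h.num K t ht (h01.trans hK)⟩

/-- The contour budget of the route: `contourBudget Nanc ϱ jstar K = Nanc · ϱ^{K − jstar K + 1} / (1 − ϱ)`.
[folklore] -/
def contourBudget (Nanc ϱ : ℝ) (jstar : ℕ → ℕ) (K : ℕ) : ℝ := Nanc * (ϱ ^ (K - jstar K + 1) / (1 - ϱ))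

/-- the contour budget is nonnegative for `Nanc ≥ 0`, `0 ≤ ϱ < 1` [folklore] -/
theorem contourBudget_nonneg {Nanc ϱ : ℝ} (hN : 0 ≤ Nanc) (h0 : 0 ≤ ϱ) (h1 : ϱ < 1) (jstar : ℕ → ℕ) (K : ℕ) :
    0 ≤ contourBudget Nanc ϱ jstar K :=
  mul_nonneg hN (div_nonneg (pow_nonneg h0 _) (by linarith))

/-- **SUMMABILITY OF THE CONTOUR BUDGET over the number of steps** when the matching scale leaves a positive fraction
of the steps old: `c·K ≤ K − j⋆(K)` (interface condition I-1 of node U5), `0 < ϱ < 1`. [folklore] -/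
theorem summable_contourBudget {Nanc ϱ c : ℝ} (hN : 0 ≤ Nanc) (h0 : 0 < ϱ) (h1 : ϱ < 1) (hc : 0 < c)
    {jstar : ℕ → ℕ} (hfrac : ∀ K : ℕ, c * K ≤ ((K - jstar K : ℕ) : ℝ)) :
    Summable (contourBudget Nanc ϱ jstar) := by
  have h := summable_weightMajorant (V := Nanc * ϱ / (1 - ϱ)) h0 h1
    (by have : 0 < 1 - ϱ := by linarith
        positivity) hc hfrac
  refine h.congr fun K => ?_
  simp only [contourBudget, pow_succ]
  field_simp

/-- **CONTOUR DATA ⇒ `ContourBound`** (leaf A5, the §1 sum run at every `(K, t)` from `K₀` on).  The contour data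
may depend on `(K, t)` (shapes `Sh K t`, pinned classes `Pin K t`, sizes `sz K`); the constants `Nanc, Δ₁, s₁` and the
matching scale `jstar` may not.  Binders = leaves A1 (count), A2 (cover, sizes `≥ K − jstar K + 1`), A3 (pinned
bound), positivity of the terms (interface I-2). [folklore] -/
theorem contourBound_of_contours [DecidableEq ι] (Sh : ℕ → ℝ → Finset β) (Pin : ℕ → ℝ → β → Finset ι)
    (sz : ℕ → β → ℕ) {Nanc Δ₁ s₁ : ℝ} {jstar : ℕ → ℕ}
    (hA : ∀ K t, |t| ≤ l₀ → K₀ ≤ K → ∀ τ ∈ T K, 0 ≤ A K t τ)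
    (hbad : ∀ K t, |t| ≤ l₀ → K₀ ≤ K → Bad K t ⊆ T K)
    (hPin : ∀ K t, |t| ≤ l₀ → K₀ ≤ K → ∀ b ∈ Sh K t, Pin K t b ⊆ T K)
    (hcover : ∀ K t, |t| ≤ l₀ → K₀ ≤ K → Bad K t ⊆ (Sh K t).biUnion (Pin K t))
    (hsize : ∀ K t, |t| ≤ l₀ → K₀ ≤ K → ∀ b ∈ Sh K t, K - jstar K + 1 ≤ sz K b)
    (hcount : ∀ K t, |t| ≤ l₀ → K₀ ≤ K → ∀ n, (((Sh K t).filter fun b => sz K b = n).card : ℝ) ≤ Nanc * Δ₁ ^ n)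
    (hpin : ∀ K t, |t| ≤ l₀ → K₀ ≤ K → ∀ b ∈ Sh K t,
      ∑ τ ∈ Pin K t b, A K t τ ≤ Real.exp (-s₁) ^ sz K b * nup K t)
    (hnup : ∀ K t, |t| ≤ l₀ → K₀ ≤ K → 0 ≤ nup K t)
    (hNanc : 0 ≤ Nanc) (hΔ₁ : 0 ≤ Δ₁) (hϱ : Δ₁ * Real.exp (-s₁) < 1) :
    ContourBound l₀ T A Bad nup (contourBudget Nanc (Δ₁ * Real.exp (-s₁)) jstar) K₀ where
  bad_subset := hbad
  num K t ht hK := by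
    unfold contourBudget
    exact sum_bad_le_of_contours (Bad K t) (T K) (A K t) (Sh K t) (Pin K t) (sz K) (hA K t ht hK)
      (hPin K t ht hK) (hcover K t ht hK) (hsize K t ht hK) (hcount K t ht hK) (hpin K t ht hK) hNanc hΔ₁
      (hnup K t ht hK) hϱ

end Numerator

/-! ## §3 Numerator (contours) ÷ denominator (`LowEnvelope` from (B)) ⇒ NE7b's output shape, two runs -/

section Extraction

variable {ι : Type*} {l₀ : ℝ} {T : ℕ → Finset ι} {A B : ℕ → ℝ → ι → ℝ} {Bad : ℕ → ℝ → Finset ι}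
  {nup mup nlow mlow : ℕ → ℝ → ℝ} {M : ℕ → ℝ} {C : ℝ} {K₀ : ℕ}

/-- ONE RUN: `ContourBound` (numerator) + `LowEnvelope` (denominator: (G2) `nlow ≤ Σ_T A`, (G5) `nup ≤ C·nlow`) ⇒ the
bad class has RELATIVE weight `≤ C · M K` from `K₀` on.  `Σ_{Bad} A ≤ M·nup ≤ M·C·nlow ≤ (C·M)·Σ_T A`. [folklore] -/
theorem ContourBound.sum_bad_le (h : ContourBound l₀ T A Bad nup M K₀) (hE : LowEnvelope l₀ T A nlow nup C K₀)
    (hC : 0 ≤ C) (hM0 : ∀ K, K₀ ≤ K → 0 ≤ M K) {K : ℕ} {t : ℝ} (ht : |t| ≤ l₀) (hK : K₀ ≤ K) :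
    ∑ τ ∈ Bad K t, A K t τ ≤ (C * M K) * ∑ τ ∈ T K, A K t τ :=
  calc ∑ τ ∈ Bad K t, A K t τ ≤ M K * nup K t := h.num K t ht hK
    _ ≤ M K * (C * nlow K t) := mul_le_mul_of_nonneg_left (hE.ratio K t ht hK) (hM0 K hK)
    _ = (C * M K) * nlow K t := by ring
    _ ≤ (C * M K) * ∑ τ ∈ T K, A K t τ :=
        mul_le_mul_of_nonneg_left (hE.low K t ht hK) (mul_nonneg hC (hM0 K hK))

/-- **TWO RUNS ⇒ `RelWeightBound`** with an explicit threshold: if both runs carry a `ContourBound` with the common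
budget `M` and a `LowEnvelope` with the common constant `C`, `0 ≤ M`, `C · M K < 1` for `K ≥ K₀` and `Σ M < ∞`, then
NE7b's output shape holds with the bad classes EMPTIED below `K₀` and `W = 𝟙_{K ≥ K₀}·C·M`
(`T4WeightBudget.relWeightBound_of_eventually`). [folklore] -/
theorem relWeightBound_of_contourBound (hA : ContourBound l₀ T A Bad nup M K₀)
    (hB : ContourBound l₀ T B Bad mup M K₀) (hEA : LowEnvelope l₀ T A nlow nup C K₀)
    (hEB : LowEnvelope l₀ T B mlow mup C K₀) (hC : 0 ≤ C) (hM0 : ∀ K, K₀ ≤ K → 0 ≤ M K)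
    (hM1 : ∀ K, K₀ ≤ K → C * M K < 1) (hMs : Summable M) :
    RelWeightBound l₀ T A B (fun K t => if K₀ ≤ K then Bad K t else ∅)
      (Set.indicator {K | K₀ ≤ K} (fun K => C * M K)) :=
  relWeightBound_of_eventually hA.bad_subset (fun K hK => mul_nonneg hC (hM0 K hK)) hM1 (hMs.mul_left C)
    (fun _ _ ht hK => hA.sum_bad_le hEA hC hM0 ht hK) (fun _ _ ht hK => hB.sum_bad_le hEB hC hM0 ht hK)

/-- **THRESHOLD-FREE COROLLARY**: with a nonnegative SUMMABLE budget the condition `C · M K < 1` holds from some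
`K₁ ≥ K₀` on by itself (`M K → 0`); the size of `C` (e.g. `e^{c·vol}`) only moves `K₁`. [folklore] -/
theorem exists_relWeightBound_of_contourBound (hA : ContourBound l₀ T A Bad nup M K₀)
    (hB : ContourBound l₀ T B Bad mup M K₀) (hEA : LowEnvelope l₀ T A nlow nup C K₀)
    (hEB : LowEnvelope l₀ T B mlow mup C K₀) (hC : 0 ≤ C) (hM0 : ∀ K, 0 ≤ M K) (hMs : Summable M) :
    ∃ K₁, K₀ ≤ K₁ ∧ RelWeightBound l₀ T A B (fun K t => if K₁ ≤ K then Bad K t else ∅)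
      (Set.indicator {K | K₁ ≤ K} (fun K => C * M K)) := by
  have hlim : Tendsto (fun K => C * M K) atTop (𝓝 0) := by
    simpa using (hMs.tendsto_atTop_zero).const_mul C
  obtain ⟨K₂, hK₂⟩ := eventually_atTop.1 (hlim.eventually (gt_mem_nhds one_pos))
  refine ⟨max K₀ K₂, le_max_left _ _, ?_⟩
  exact relWeightBound_of_contourBound (hA.of_le (le_max_left _ _)) (hB.of_le (le_max_left _ _))
    (hEA.of_le (le_max_left _ _)) (hEB.of_le (le_max_left _ _)) hC (fun K _ => hM0 K)
    (fun K hK => hK₂ K ((le_max_right _ _).trans hK)) hMs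

end Extraction

/-! ## §4 End to end: the leaves A1–A4 of the skeleton ⇒ `RelWeightBound` -/

section EndToEnd

variable {ι β : Type*} [DecidableEq ι] {l₀ : ℝ} {T : ℕ → Finset ι} {A B : ℕ → ℝ → ι → ℝ}
  {Bad : ℕ → ℝ → Finset ι} {nup mup nlow mlow : ℕ → ℝ → ℝ} {C : ℝ} {K₀ : ℕ}

/-- **THE ROUTE, ASSEMBLED** (skeleton `NE7b-t4-ne7b-p3.md` §3): for BOTH runs — positivity of the terms (I-2), the
contour COVER of the bad class by pinned classes of contours of `≥ K − j⋆(K) + 1` cells (A2), the ANIMAL count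
`≤ Nanc·Δ₁ⁿ` (A1), the PINNED-CONTOUR bound `≤ (e^{−s₁})ⁿ·nup` (A3), the denominator `LowEnvelope` with a common `C`
from the pinned (B) (A4, `T4StabilitySocket.lowEnvelope_of_endStatementBPrinted`) — together with the SURVIVAL
CONDITION `Δ₁·e^{−s₁} < 1` and the matching-scale fraction `c·K ≤ K − j⋆(K)` (I-1), give NE7b's output shape
`RelWeightBound` with `W = 𝟙_{K ≥ K₁}·C·Nanc·ϱ^{K−j⋆(K)+1}/(1−ϱ)` from some `K₁ ≥ K₀` on.  Every named estimate is a
binder; nothing of Bałaban's is asserted. [folklore] -/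
theorem exists_relWeightBound_of_peierls
    (ShA ShB : ℕ → ℝ → Finset β) (PinA PinB : ℕ → ℝ → β → Finset ι) (sz : ℕ → β → ℕ)
    {Nanc Δ₁ s₁ c : ℝ} {jstar : ℕ → ℕ}
    -- interface I-2: nonnegative terms, both runs
    (hA : ∀ K t, |t| ≤ l₀ → K₀ ≤ K → ∀ τ ∈ T K, 0 ≤ A K t τ)
    (hB : ∀ K t, |t| ≤ l₀ → K₀ ≤ K → ∀ τ ∈ T K, 0 ≤ B K t τ)
    (hbad : ∀ K t, |t| ≤ l₀ → K₀ ≤ K → Bad K t ⊆ T K)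
    -- leaf A2 (cover by contours of size ≥ K − j⋆ + 1), both runs
    (hPinA : ∀ K t, |t| ≤ l₀ → K₀ ≤ K → ∀ b ∈ ShA K t, PinA K t b ⊆ T K)
    (hPinB : ∀ K t, |t| ≤ l₀ → K₀ ≤ K → ∀ b ∈ ShB K t, PinB K t b ⊆ T K)
    (hcovA : ∀ K t, |t| ≤ l₀ → K₀ ≤ K → Bad K t ⊆ (ShA K t).biUnion (PinA K t))
    (hcovB : ∀ K t, |t| ≤ l₀ → K₀ ≤ K → Bad K t ⊆ (ShB K t).biUnion (PinB K t))
    (hszA : ∀ K t, |t| ≤ l₀ → K₀ ≤ K → ∀ b ∈ ShA K t, K - jstar K + 1 ≤ sz K b)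
    (hszB : ∀ K t, |t| ≤ l₀ → K₀ ≤ K → ∀ b ∈ ShB K t, K - jstar K + 1 ≤ sz K b)
    -- leaf A1 (animal count), both runs
    (hcntA : ∀ K t, |t| ≤ l₀ → K₀ ≤ K → ∀ n, (((ShA K t).filter fun b => sz K b = n).card : ℝ) ≤ Nanc * Δ₁ ^ n)
    (hcntB : ∀ K t, |t| ≤ l₀ → K₀ ≤ K → ∀ n, (((ShB K t).filter fun b => sz K b = n).card : ℝ) ≤ Nanc * Δ₁ ^ n)
    -- leaf A3 (pinned-contour bound), both runs
    (hpinA : ∀ K t, |t| ≤ l₀ → K₀ ≤ K → ∀ b ∈ ShA K t,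
      ∑ τ ∈ PinA K t b, A K t τ ≤ Real.exp (-s₁) ^ sz K b * nup K t)
    (hpinB : ∀ K t, |t| ≤ l₀ → K₀ ≤ K → ∀ b ∈ ShB K t,
      ∑ τ ∈ PinB K t b, B K t τ ≤ Real.exp (-s₁) ^ sz K b * mup K t)
    -- leaf A4 (denominator from (B)), both runs, common constant
    (hEA : LowEnvelope l₀ T A nlow nup C K₀) (hEB : LowEnvelope l₀ T B mlow mup C K₀) (hC : 0 ≤ C)
    -- constants, survival condition, matching-scale fraction (I-1)
    (hNanc : 0 ≤ Nanc) (hΔ₁ : 0 < Δ₁) (hϱ : Δ₁ * Real.exp (-s₁) < 1) (hc : 0 < c)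
    (hfrac : ∀ K : ℕ, c * K ≤ ((K - jstar K : ℕ) : ℝ)) :
    ∃ K₁, K₀ ≤ K₁ ∧ RelWeightBound l₀ T A B (fun K t => if K₁ ≤ K then Bad K t else ∅)
      (Set.indicator {K | K₁ ≤ K} (fun K => C * contourBudget Nanc (Δ₁ * Real.exp (-s₁)) jstar K)) := by
  have hϱ0 : 0 < Δ₁ * Real.exp (-s₁) := mul_pos hΔ₁ (Real.exp_pos _)
  have hCA := contourBound_of_contours ShA PinA sz hA hbad hPinA hcovA hszA hcntA hpinA
    (fun K t ht hK => hEA.nup_nonneg K t ht hK) hNanc hΔ₁.le hϱ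
  have hCB := contourBound_of_contours ShB PinB sz hB hbad hPinB hcovB hszB hcntB hpinB
    (fun K t ht hK => hEB.nup_nonneg K t ht hK) hNanc hΔ₁.le hϱ
  exact exists_relWeightBound_of_contourBound hCA hCB hEA hEB hC
    (contourBudget_nonneg hNanc hϱ0.le hϱ jstar) (summable_contourBudget hNanc hϱ0 hϱ hc hfrac)

end EndToEnd

/-! ## §5 A decided toy: every binder of §1 at once, non-vacuously -/

section Toy

/-- toy: two terms, the bad one (`true`) pinned by the single contour shape `()` of size `m`, weight `(1/4)^m`;
the good one of weight `1`; `nup = 1`, `Nanc = 1`, `Δ₁ = 2`, `e^{−s₁} = 1/4` (so `ϱ = 1/2`). [folklore] -/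
example (m : ℕ) :
    ∑ τ ∈ ({true} : Finset Bool), (fun b : Bool => if b then (1 / 4 : ℝ) ^ m else 1) τ
      ≤ 1 * ((2 * Real.exp (-Real.log 4)) ^ m / (1 - 2 * Real.exp (-Real.log 4))) * 1 := by
  have h4 : Real.exp (-Real.log 4) = 1 / 4 := by
    rw [Real.exp_neg, Real.exp_log (by norm_num : (0:ℝ) < 4)]; norm_num
  refine sum_bad_le_of_contours ({true} : Finset Bool) univ _ ({()} : Finset Unit) (fun _ => {true}) (fun _ => m)
    (Nanc := 1) (Δ₁ := 2) (s₁ := Real.log 4) (nup := 1) (m := m)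
    (fun τ _ => by split_ifs <;> positivity) (fun _ _ => subset_univ _)
    (by simp) (fun _ _ => le_rfl) (fun n => ?_) (fun b _ => ?_) zero_le_one (by norm_num) zero_le_one ?_
  · -- count: the fibre has ≤ 1 element ≤ 1·2ⁿ
    calc (((({()} : Finset Unit).filter fun _ => m = n).card : ℕ) : ℝ) ≤ 1 := by
          exact_mod_cast (card_filter_le _ _).trans (by simp)
      _ ≤ 1 * 2 ^ n := by rw [one_mul]; exact one_le_pow₀ (by norm_num)
  · simp [h4]
  · rw [h4]; norm_num

end Toy

end

end Summit.QuantumFields.BalabanUV.T4Continuum.SpaceTimePeierls
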